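import Summits.CriticalPhenomena.SAWScalingLimit.Theorems.SAWDefectDecoherenceBoundaryClosureRSidePhaseCornerStepsThree
import HarnessLib

/-!
# Crux `BoundaryClosureR` (stmt-CriticalPhenomena-14004), line `polygon-parity-squeeze`:
# the corner steps of the winding at the lattice corners of forms `0` and `2`
# (support for the corner phase relation `sidePhase_corner`, sub-goal (A1b') of
# `stub_polygonIdentification`)

Companion of `…SidePhaseCornerStepsThree`: the second side is now a column `x₀ = a` of form `2`
(darts heading `150°`), meeting the floor of row `n` at a convex `60°` corner or at a reflex
`300°` corner.  A walk from the boundary root reaching the window joining the last floor dart to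
the first column dart is cut at its first visit (`SidePhaseCorner.first_visit`) and rerouted to
both darts; the windings differ by the turning `-2π/3` of the boundary at the corner:

* `step_two_convex` (one tip face `(a,n,0)` carrying both darts; one entrance);
* `step_two_reflex` (window `(a-1,n,0), (a-1,n,1), (a,n,0), (a,n-1,1), (a,n-1,0)`, both darts
  hanging into the exterior tip `(a-1,n-1,1)`; five entrances).

Sources: H. Duminil-Copin, S. Smirnov, Ann. of Math. 175 (2012), §3.  No definition is
introduced.
-/

noncomputable section

open Literature.Probability.LatticeModels Literature.Probability.RandomPlanarGeometry.SAW
open Literature.Probability.RandomPlanarGeometry.SAW.HV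
open Summit.CriticalPhenomena.SAWScalingLimit.Theorems.PickHalfPlane.BoundaryExactness

namespace Summit.CriticalPhenomena.SAWScalingLimit.Theorems.PolygonParitySqueeze

namespace SidePhaseCorner

variable {Λ : Finset HexVertex}

/-! ### 1. The `60°` corner: floor of row `n`, then the column `x₀ = a` of form `2` -/

/-- **Corner step at a convex corner of forms `0`, `2` (`60°`).** The tip face `U = (a,n,0)`
carries both the last floor dart (down to `(a,n-1,1) ∉ Λ`) and the first column dart (heading
`150°` to `(a-1,n,1) ∉ Λ`), neither being the root.  A walk from the root meeting `U` (necessarily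
from `(a,n,1)`) is rerouted to both darts; the winding to the column dart is the winding to the
floor dart minus `2π/3`. [cite: DuminilCopinSmirnov2012, §3 (winding of walks to the boundary)] -/
theorem step_two_convex {u w : HexVertex} (hu : u ∉ Λ) (huw : hexGraph.Adj u w) {a n : ℤ}
    (hU : ((![a, n], 0) : HexVertex) ∈ Λ)
    (hB : ((![a, n - 1], 1) : HexVertex) ∉ Λ) (hE : ((![a - 1, n], 1) : HexVertex) ∉ Λ)
    (h0 : s(u, w) ≠ s(((![a, n - 1], 1) : HexVertex), ((![a, n], 0) : HexVertex)))
    (h1 : s(u, w) ≠ s(((![a - 1, n], 1) : HexVertex), ((![a, n], 0) : HexVertex)))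
    {z : Sym2 HexVertex} (δ : HexMidEdgeSAW Λ s(u, w) z)
    (hvis : ∃ v ∈ δ.verts, v ∈ [((![a, n], 0) : HexVertex)]) :
    ∃ (γ₀ : HexMidEdgeSAW Λ s(u, w) s(((![a, n - 1], 1) : HexVertex), ((![a, n], 0) : HexVertex)))
      (γ₁ : HexMidEdgeSAW Λ s(u, w) s(((![a - 1, n], 1) : HexVertex), ((![a, n], 0) : HexVertex))),
      γ₁.winding = γ₀.winding - 2 * Real.pi / 3 := by
  have hZ : ∀ x ∈ [((![a, n], 0) : HexVertex)], x ∈ Λ := by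
    simp only [List.mem_cons, List.not_mem_nil, or_false]
    rintro x rfl; exact hU
  obtain ⟨A, B, zv, p, hsplit, hzv, hA, hp, hpadj, hpout, -⟩ := first_visit hu huw δ _ hZ hvis
  have hAS : ∀ S : List HexVertex, (∀ x ∈ S, x ∈ [((![a, n], 0) : HexVertex)]) →
      ∀ x ∈ A, x ∉ S := fun S hS x hx hxS => hA x hx (hS x hxS)
  have aBU : hexGraph.Adj ((![a, n - 1], 1) : HexVertex) (![a, n], 0) := by
    rw [hexGraph_adj_iff_coord]; simp
  have aEU : hexGraph.Adj ((![a - 1, n], 1) : HexVertex) (![a, n], 0) := by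
    rw [hexGraph_adj_iff_coord]; simp
  simp only [List.mem_cons, List.not_mem_nil, or_false] at hzv
  subst hzv
  obtain ⟨h2, ⟨hx, hy⟩ | ⟨hx, hy⟩ | ⟨hx, hy⟩⟩ := adj_up_coord hpadj
  · have hpe : p = (![a, n], 1) := eq_mk_of_coord hx hy h2
    subst hpe
    obtain ⟨γ₀, h₀⟩ := exists_extend hu huw δ hsplit [] (![a, n - 1], 1) (![a, n], 0)
      (by simpa using hU) (List.nodup_singleton _) (List.isChain_singleton _)
      (hAS _ (by simp)) rfl hB aBU h0
    obtain ⟨γ₁, h₁⟩ := exists_extend hu huw δ hsplit [] (![a - 1, n], 1) (![a, n], 0)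
      (by simpa using hU) (List.nodup_singleton _) (List.isChain_singleton _)
      (hAS _ (by simp)) rfl hE aEU h1
    refine ⟨γ₀, γ₁, ?_⟩
    rw [hp] at h₀ h₁
    simp only [List.nil_append, List.map_cons, List.map_nil, toHV_up, toHV_down] at h₀ h₁
    have e₀ : pturn [(a, n, true), (a, n, false), (a, n - 1, true)] = 1 := by
      simp only [pturn, turn, cross, pos, Bool.false_eq_true, ↓reduceIte, Prod.mk_sub_mk]
      ring_nf; rfl
    have e₁ : pturn [(a, n, true), (a, n, false), (a - 1, n, true)] = -1 := by
      simp only [pturn, turn, cross, pos, Bool.false_eq_true, ↓reduceIte, Prod.mk_sub_mk]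
      ring_nf; rfl
    rw [h₀, h₁, e₀, e₁]; push_cast; ring
  · obtain ⟨hux, hzw⟩ := hpout _ hE (eq_mk_of_coord hx hy h2)
    exact absurd (by rw [hux, ← hzw]) h1
  · obtain ⟨hux, hzw⟩ := hpout _ hB (eq_mk_of_coord hx hy h2)
    exact absurd (by rw [hux, ← hzw]) h0

/-! ### 2. The `300°` corner -/

/-- **Corner step at a reflex corner of forms `0`, `2` (`300°`).** Window: the last floor up face
`U = (a-1,n,0)`, the interior faces `(a-1,n,1)`, `(a,n,0)`, `(a,n-1,1)`, and the first column face
`V = (a,n-1,0)`; both darts hang into the exterior tip `(a-1,n-1,1) ∉ Λ` (down from `U`, heading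
`150°` from `V`), neither being the root.  A walk from the root meeting the window is rerouted at
its first visit (five possible entrances) to both darts; the winding to the column dart is the
winding to the floor dart minus `2π/3`. [cite: DuminilCopinSmirnov2012, §3 (winding of walks to the boundary)] -/
theorem step_two_reflex {u w : HexVertex} (hu : u ∉ Λ) (huw : hexGraph.Adj u w) {a n : ℤ}
    (hU : ((![a - 1, n], 0) : HexVertex) ∈ Λ) (hQ₁ : ((![a - 1, n], 1) : HexVertex) ∈ Λ)
    (hQ₂ : ((![a, n], 0) : HexVertex) ∈ Λ) (hQ₃ : ((![a, n - 1], 1) : HexVertex) ∈ Λ)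
    (hV : ((![a, n - 1], 0) : HexVertex) ∈ Λ) (hB : ((![a - 1, n - 1], 1) : HexVertex) ∉ Λ)
    (h0 : s(u, w) ≠ s(((![a - 1, n - 1], 1) : HexVertex), ((![a - 1, n], 0) : HexVertex)))
    (h1 : s(u, w) ≠ s(((![a - 1, n - 1], 1) : HexVertex), ((![a, n - 1], 0) : HexVertex)))
    {z : Sym2 HexVertex} (δ : HexMidEdgeSAW Λ s(u, w) z)
    (hvis : ∃ v ∈ δ.verts, v ∈ [((![a - 1, n], 0) : HexVertex), (![a - 1, n], 1), (![a, n], 0),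
      (![a, n - 1], 1), (![a, n - 1], 0)]) :
    ∃ (γ₀ : HexMidEdgeSAW Λ s(u, w) s(((![a - 1, n - 1], 1) : HexVertex), ((![a - 1, n], 0) : HexVertex)))
      (γ₁ : HexMidEdgeSAW Λ s(u, w) s(((![a - 1, n - 1], 1) : HexVertex), ((![a, n - 1], 0) : HexVertex))),
      γ₁.winding = γ₀.winding - 2 * Real.pi / 3 := by
  have hZ : ∀ x ∈ [((![a - 1, n], 0) : HexVertex), (![a - 1, n], 1), (![a, n], 0), (![a, n - 1], 1),
      (![a, n - 1], 0)], x ∈ Λ := by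
    simp only [List.mem_cons, List.not_mem_nil, or_false]
    rintro x (rfl | rfl | rfl | rfl | rfl) <;> assumption
  obtain ⟨A, B, zv, p, hsplit, hzv, hA, hp, hpadj, hpout, hpZ⟩ := first_visit hu huw δ _ hZ hvis
  have hAS : ∀ S : List HexVertex, (∀ x ∈ S, x ∈ [((![a - 1, n], 0) : HexVertex), (![a - 1, n], 1),
      (![a, n], 0), (![a, n - 1], 1), (![a, n - 1], 0)]) → ∀ x ∈ A, x ∉ S :=
    fun S hS x hx hxS => hA x hx (hS x hxS)
  -- lattice adjacencies along the window and at its two darts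
  have aBU : hexGraph.Adj ((![a - 1, n - 1], 1) : HexVertex) (![a - 1, n], 0) := by
    rw [hexGraph_adj_iff_coord]; simp
  have aBV : hexGraph.Adj ((![a - 1, n - 1], 1) : HexVertex) (![a, n - 1], 0) := by
    rw [hexGraph_adj_iff_coord]; simp
  have a01 : hexGraph.Adj ((![a - 1, n], 0) : HexVertex) (![a - 1, n], 1) := by
    rw [hexGraph_adj_iff_coord]; simp
  have a12 : hexGraph.Adj ((![a - 1, n], 1) : HexVertex) (![a, n], 0) := by
    rw [hexGraph_adj_iff_coord]; simp
  have a23 : hexGraph.Adj ((![a, n], 0) : HexVertex) (![a, n - 1], 1) := by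
    rw [hexGraph_adj_iff_coord]; simp
  have a34 : hexGraph.Adj ((![a, n - 1], 1) : HexVertex) (![a, n - 1], 0) := by
    rw [hexGraph_adj_iff_coord]; simp
  simp only [List.mem_cons, List.not_mem_nil, or_false] at hzv
  rcases hzv with rfl | rfl | rfl | rfl | rfl
  · -- at `U = (a-1,n,0)`: from `(a-1,n,1)` (window), from the west `(a-2,n,1)`, from below (root)
    obtain ⟨h2, ⟨hx, hy⟩ | ⟨hx, hy⟩ | ⟨hx, hy⟩⟩ := adj_up_coord hpadj
    · exact absurd (eq_mk_of_coord hx hy h2) (hpZ _ (by simp))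
    · have hpe : p = (![a - 2, n], 1) := eq_mk_of_coord (by omega) hy h2
      subst hpe
      obtain ⟨γ₀, h₀⟩ := exists_extend hu huw δ hsplit [] (![a - 1, n - 1], 1) (![a - 1, n], 0)
        (by simpa using hU) (List.nodup_singleton _) (List.isChain_singleton _)
        (hAS _ (by simp)) rfl hB aBU h0
      obtain ⟨γ₁, h₁⟩ := exists_extend hu huw δ hsplit
        [(![a - 1, n], 1), (![a, n], 0), (![a, n - 1], 1), (![a, n - 1], 0)]
        (![a - 1, n - 1], 1) (![a, n - 1], 0)
        (by simp only [List.mem_cons, List.not_mem_nil, or_false]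
            rintro x (rfl | rfl | rfl | rfl | rfl) <;> assumption)
        (by simp; omega)
        (List.isChain_cons_cons.2 ⟨a01, List.isChain_cons_cons.2 ⟨a12,
          List.isChain_cons_cons.2 ⟨a23, List.isChain_pair.2 a34⟩⟩⟩)
        (hAS _ (by simp)) rfl hB aBV h1
      refine ⟨γ₀, γ₁, ?_⟩
      rw [hp] at h₀ h₁
      simp only [List.nil_append, List.cons_append, List.map_cons, List.map_nil, toHV_up,
        toHV_down] at h₀ h₁
      have e₀ : pturn [(a - 2, n, true), (a - 1, n, false), (a - 1, n - 1, true)] = -1 := by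
        simp only [pturn, turn, cross, pos, Bool.false_eq_true, ↓reduceIte, Prod.mk_sub_mk]
        ring_nf; rfl
      have e₁ : pturn [(a - 2, n, true), (a - 1, n, false), (a - 1, n, true), (a, n, false),
          (a, n - 1, true), (a, n - 1, false), (a - 1, n - 1, true)] = -3 := by
        simp only [pturn, turn, cross, pos, Bool.false_eq_true, ↓reduceIte, Prod.mk_sub_mk]
        ring_nf; rfl
      rw [h₀, h₁, e₀, e₁]; push_cast; ring
    · obtain ⟨hux, hzw⟩ := hpout _ hB (eq_mk_of_coord hx hy h2)
      exact absurd (by rw [hux, ← hzw]) h0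
  · -- at `(a-1,n,1)`: from `U` (window), from `(a,n,0)` (window), from above `(a-1,n+1,0)`
    obtain ⟨h2, ⟨hx, hy⟩ | ⟨hx, hy⟩ | ⟨hx, hy⟩⟩ := adj_down_coord hpadj
    · exact absurd (eq_mk_of_coord hx hy h2) (hpZ _ (by simp))
    · exact absurd (eq_mk_of_coord (c := a) (by omega) hy h2) (hpZ _ (by simp))
    · have hpe : p = (![a - 1, n + 1], 0) := eq_mk_of_coord hx hy h2
      subst hpe
      obtain ⟨γ₀, h₀⟩ := exists_extend hu huw δ hsplit [(![a - 1, n], 0)] (![a - 1, n - 1], 1)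
        (![a - 1, n], 0)
        (by simp only [List.mem_cons, List.not_mem_nil, or_false]
            rintro x (rfl | rfl) <;> assumption)
        (by simp) (List.isChain_pair.2 a01.symm) (hAS _ (by simp)) rfl hB aBU h0
      obtain ⟨γ₁, h₁⟩ := exists_extend hu huw δ hsplit [(![a, n], 0), (![a, n - 1], 1), (![a, n - 1], 0)]
        (![a - 1, n - 1], 1) (![a, n - 1], 0)
        (by simp only [List.mem_cons, List.not_mem_nil, or_false]
            rintro x (rfl | rfl | rfl | rfl) <;> assumption)
        (by simp; omega)
        (List.isChain_cons_cons.2 ⟨a12, List.isChain_cons_cons.2 ⟨a23, List.isChain_pair.2 a34⟩⟩)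
        (hAS _ (by simp)) rfl hB aBV h1
      refine ⟨γ₀, γ₁, ?_⟩
      rw [hp] at h₀ h₁
      simp only [List.nil_append, List.cons_append, List.map_cons, List.map_nil, toHV_up,
        toHV_down] at h₀ h₁
      have e₀ : pturn [(a - 1, n + 1, false), (a - 1, n, true), (a - 1, n, false),
          (a - 1, n - 1, true)] = 0 := by
        simp only [pturn, turn, cross, pos, Bool.false_eq_true, ↓reduceIte, Prod.mk_sub_mk]
        ring_nf; rfl
      have e₁ : pturn [(a - 1, n + 1, false), (a - 1, n, true), (a, n, false), (a, n - 1, true),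
          (a, n - 1, false), (a - 1, n - 1, true)] = -2 := by
        simp only [pturn, turn, cross, pos, Bool.false_eq_true, ↓reduceIte, Prod.mk_sub_mk]
        ring_nf; rfl
      rw [h₀, h₁, e₀, e₁]; push_cast; ring
  · -- at `(a,n,0)`: from `(a,n,1)` (interior), from `(a-1,n,1)` (window), from `(a,n-1,1)` (window)
    obtain ⟨h2, ⟨hx, hy⟩ | ⟨hx, hy⟩ | ⟨hx, hy⟩⟩ := adj_up_coord hpadj
    · have hpe : p = (![a, n], 1) := eq_mk_of_coord hx hy h2
      subst hpe
      obtain ⟨γ₀, h₀⟩ := exists_extend hu huw δ hsplit [(![a - 1, n], 1), (![a - 1, n], 0)]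
        (![a - 1, n - 1], 1) (![a - 1, n], 0)
        (by simp only [List.mem_cons, List.not_mem_nil, or_false]
            rintro x (rfl | rfl | rfl) <;> assumption)
        (by simp; omega)
        (List.isChain_cons_cons.2 ⟨a12.symm, List.isChain_pair.2 a01.symm⟩)
        (hAS _ (by simp)) rfl hB aBU h0
      obtain ⟨γ₁, h₁⟩ := exists_extend hu huw δ hsplit [(![a, n - 1], 1), (![a, n - 1], 0)]
        (![a - 1, n - 1], 1) (![a, n - 1], 0)
        (by simp only [List.mem_cons, List.not_mem_nil, or_false]
            rintro x (rfl | rfl | rfl) <;> assumption)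
        (by simp; omega)
        (List.isChain_cons_cons.2 ⟨a23, List.isChain_pair.2 a34⟩)
        (hAS _ (by simp)) rfl hB aBV h1
      refine ⟨γ₀, γ₁, ?_⟩
      rw [hp] at h₀ h₁
      simp only [List.nil_append, List.cons_append, List.map_cons, List.map_nil, toHV_up,
        toHV_down] at h₀ h₁
      have e₀ : pturn [(a, n, true), (a, n, false), (a - 1, n, true), (a - 1, n, false),
          (a - 1, n - 1, true)] = 1 := by
        simp only [pturn, turn, cross, pos, Bool.false_eq_true, ↓reduceIte, Prod.mk_sub_mk]
        ring_nf; rfl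
      have e₁ : pturn [(a, n, true), (a, n, false), (a, n - 1, true), (a, n - 1, false),
          (a - 1, n - 1, true)] = -1 := by
        simp only [pturn, turn, cross, pos, Bool.false_eq_true, ↓reduceIte, Prod.mk_sub_mk]
        ring_nf; rfl
      rw [h₀, h₁, e₀, e₁]; push_cast; ring
    · exact absurd (eq_mk_of_coord hx hy h2) (hpZ _ (by simp))
    · exact absurd (eq_mk_of_coord hx hy h2) (hpZ _ (by simp))
  · -- at `(a,n-1,1)`: from `V` (window), from the east `(a+1,n-1,0)`, from `(a,n,0)` (window)
    obtain ⟨h2, ⟨hx, hy⟩ | ⟨hx, hy⟩ | ⟨hx, hy⟩⟩ := adj_down_coord hpadj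
    · exact absurd (eq_mk_of_coord hx hy h2) (hpZ _ (by simp))
    · have hpe : p = (![a + 1, n - 1], 0) := eq_mk_of_coord hx hy h2
      subst hpe
      obtain ⟨γ₀, h₀⟩ := exists_extend hu huw δ hsplit [(![a, n], 0), (![a - 1, n], 1), (![a - 1, n], 0)]
        (![a - 1, n - 1], 1) (![a - 1, n], 0)
        (by simp only [List.mem_cons, List.not_mem_nil, or_false]
            rintro x (rfl | rfl | rfl | rfl) <;> assumption)
        (by simp; omega)
        (List.isChain_cons_cons.2 ⟨a23.symm, List.isChain_cons_cons.2 ⟨a12.symm,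
          List.isChain_pair.2 a01.symm⟩⟩)
        (hAS _ (by simp)) rfl hB aBU h0
      obtain ⟨γ₁, h₁⟩ := exists_extend hu huw δ hsplit [(![a, n - 1], 0)] (![a - 1, n - 1], 1)
        (![a, n - 1], 0)
        (by simp only [List.mem_cons, List.not_mem_nil, or_false]
            rintro x (rfl | rfl) <;> assumption)
        (by simp) (List.isChain_pair.2 a34) (hAS _ (by simp)) rfl hB aBV h1
      refine ⟨γ₀, γ₁, ?_⟩
      rw [hp] at h₀ h₁
      simp only [List.nil_append, List.cons_append, List.map_cons, List.map_nil, toHV_up,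
        toHV_down] at h₀ h₁
      have e₀ : pturn [(a + 1, n - 1, false), (a, n - 1, true), (a, n, false), (a - 1, n, true),
          (a - 1, n, false), (a - 1, n - 1, true)] = 2 := by
        simp only [pturn, turn, cross, pos, Bool.false_eq_true, ↓reduceIte, Prod.mk_sub_mk]
        ring_nf; rfl
      have e₁ : pturn [(a + 1, n - 1, false), (a, n - 1, true), (a, n - 1, false),
          (a - 1, n - 1, true)] = 0 := by
        simp only [pturn, turn, cross, pos, Bool.false_eq_true, ↓reduceIte, Prod.mk_sub_mk]
        ring_nf; rfl
      rw [h₀, h₁, e₀, e₁]; push_cast; ring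
    · exact absurd (eq_mk_of_coord hx (d := n) (by omega) h2) (hpZ _ (by simp))
  · -- at `V = (a,n-1,0)`: from `(a,n-1,1)` (window), from the tip (root), from below `(a,n-2,1)`
    obtain ⟨h2, ⟨hx, hy⟩ | ⟨hx, hy⟩ | ⟨hx, hy⟩⟩ := adj_up_coord hpadj
    · exact absurd (eq_mk_of_coord hx hy h2) (hpZ _ (by simp))
    · obtain ⟨hux, hzw⟩ := hpout _ hB (eq_mk_of_coord hx hy h2)
      exact absurd (by rw [hux, ← hzw]) h1
    · have hpe : p = (![a, n - 2], 1) := eq_mk_of_coord hx (by omega) h2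
      subst hpe
      obtain ⟨γ₀, h₀⟩ := exists_extend hu huw δ hsplit
        [(![a, n - 1], 1), (![a, n], 0), (![a - 1, n], 1), (![a - 1, n], 0)]
        (![a - 1, n - 1], 1) (![a - 1, n], 0)
        (by simp only [List.mem_cons, List.not_mem_nil, or_false]
            rintro x (rfl | rfl | rfl | rfl | rfl) <;> assumption)
        (by simp; omega)
        (List.isChain_cons_cons.2 ⟨a34.symm, List.isChain_cons_cons.2 ⟨a23.symm,
          List.isChain_cons_cons.2 ⟨a12.symm, List.isChain_pair.2 a01.symm⟩⟩⟩)
        (hAS _ (by simp)) rfl hB aBU h0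
      obtain ⟨γ₁, h₁⟩ := exists_extend hu huw δ hsplit [] (![a - 1, n - 1], 1) (![a, n - 1], 0)
        (by simpa using hV) (List.nodup_singleton _) (List.isChain_singleton _)
        (hAS _ (by simp)) rfl hB aBV h1
      refine ⟨γ₀, γ₁, ?_⟩
      rw [hp] at h₀ h₁
      simp only [List.nil_append, List.cons_append, List.map_cons, List.map_nil, toHV_up,
        toHV_down] at h₀ h₁
      have e₀ : pturn [(a, n - 2, true), (a, n - 1, false), (a, n - 1, true), (a, n, false),
          (a - 1, n, true), (a - 1, n, false), (a - 1, n - 1, true)] = 3 := by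
        simp only [pturn, turn, cross, pos, Bool.false_eq_true, ↓reduceIte, Prod.mk_sub_mk]
        ring_nf; rfl
      have e₁ : pturn [(a, n - 2, true), (a, n - 1, false), (a - 1, n - 1, true)] = 1 := by
        simp only [pturn, turn, cross, pos, Bool.false_eq_true, ↓reduceIte, Prod.mk_sub_mk]
        ring_nf; rfl
      rw [h₀, h₁, e₀, e₁]; push_cast; ring

end SidePhaseCorner

/-! ### Registered form -/

/-- **Registered helper `sidePhaseCorner_step_two_convex`** (support for `sidePhase_corner`, line
`polygon-parity-squeeze`, crux stmt-CriticalPhenomena-14004): the corner step of the winding at a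
convex corner of forms `0`, `2` (binder-free form of `SidePhaseCorner.step_two_convex`; the reflex
corner is `SidePhaseCorner.step_two_reflex`).
[cite: DuminilCopinSmirnov2012, §3 (winding of walks to the boundary)] -/
theorem sidePhaseCorner_step_two_convex : ∀ (Λ : Finset HexVertex) (u w : HexVertex), u ∉ Λ → hexGraph.Adj u w → ∀ (a n : ℤ), ((![a, n], 0) : HexVertex) ∈ Λ → ((![a, n - 1], 1) : HexVertex) ∉ Λ → ((![a - 1, n], 1) : HexVertex) ∉ Λ → s(u, w) ≠ s(((![a, n - 1], 1) : HexVertex), ((![a, n], 0) : HexVertex)) → s(u, w) ≠ s(((![a - 1, n], 1) : HexVertex), ((![a, n], 0) : HexVertex)) → ∀ (z : Sym2 HexVertex) (δ : HexMidEdgeSAW Λ s(u, w) z), (∃ v ∈ δ.verts, v ∈ [((![a, n], 0) : HexVertex)]) → ∃ (γ₀ : HexMidEdgeSAW Λ s(u, w) s(((![a, n - 1], 1) : HexVertex), ((![a, n], 0) : HexVertex))) (γ₁ : HexMidEdgeSAW Λ s(u, w) s(((![a - 1, n], 1) : HexVertex), ((![a, n], 0) : HexVertex))), γ₁.winding = γ₀.winding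 - 2 * Real.pi / 3 :=
  fun _ _ _ hu huw _ _ hU hB hE h0 h1 _ δ hvis =>
    SidePhaseCorner.step_two_convex hu huw hU hB hE h0 h1 δ hvis

end Summit.CriticalPhenomena.SAWScalingLimit.Theorems.PolygonParitySqueeze

end
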